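import Literature.AlgebraicGeometry.Motives.HodgeStructureExteriorAlgebraWeylOperatorDirectSum
import Literature.AlgebraicGeometry.Motives.HodgeStructureExteriorPowerPolarizationClass
import Literature.AlgebraicGeometry.Motives.HodgeStructureProdPolarization
import HarnessLib

/-!
# The Lefschetz class of a product: `E_{Q₁ ⊕ Q₂} = ⋀(inl) E_{Q₁} + ⋀(inr) E_{Q₂}` in `⋀²(V ⊕ W)`, and André's §1.3 (Lemme 1.3.1, 1.3.2,
# `ᶜΛ`, `w`) on the cohomology algebra `⋀(V ⊕ W) = H•(A × B)` of a product of polarized odd-weight Hodge structures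

[topic AlgebraicGeometry/Motives]

Layer `Literature/AlgebraicGeometry/Motives`, lane `lit-hodgefound` (Track 2 foundations library; prover seat `lit-hodgefound-p34`,
generation 31, row g31-#10). THEOREMS ONLY (no `def`, no named fact, no instance, no notation; net debt `0`). The CARRIER READING of
row g31-#9 (`Motives/HodgeStructureExteriorAlgebraWeylOperatorDirectSum`: André §1.3 on `⋀(W₁ ⊕ W₂)` for `ω₁ ⊞ ω₂ = ⋀(inl) ω₁ + ⋀(inr) ω₂`)
through the tree's product polarization `Polarization.prod Q₁ Q₂` (`Motives/HodgeStructureProdPolarization`, form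
`Q₁ ∘ (pr₁ × pr₁) + Q₂ ∘ (pr₂ × pr₂)`) and Lefschetz class `Polarization.lefschetzClass Q = E_Q = twoVectorOfForm Q.form`
(`Motives/HodgeStructureExteriorPowerPolarizationClass`).

## Sources, VERBATIM

Y. André, *Pour une théorie inconditionnelle des motifs*, Publ. Math. IHÉS **83** (1996) [Andre1996Motifs], §1.3 (p. 12):
"L'isomorphisme (d'algèbres graduées) de Künneth : `H•(X × Y) ≅ H•(X) ⊗ H•(Y)` devient un isomorphisme de `𝔰𝔩₂`-modules si l'on
munit `X × Y` du faisceau inversible ample `𝓛_{X×Y} = p₁*𝓛_X ⊗ p₂*𝓛_Y` […] l'inclusion `P^i(X) ⊗ P^j(Y) ⊆ P^{i+j}(X × Y)` fournie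
par cet isomorphisme est restriction de l'isomorphisme de Künneth." — p. 13, Lemme 1.3.2: "Pour l'involution de Hodge, on a la
formule `*_H x ⊗ *_H y = (−1)^{ij} *_H (x ⊗ y)`."
H. Lange, *Abelian Varieties over the Complex Numbers* (2023) [Lange2023AbelianVarietiesComplex], §7.3.2 (p. 338: "`E` considered as
an element of `⋀² V`"); P. Deligne, *Théorie de Hodge II* [DeligneHodgeII1971], 2.1.15 (direct sums of polarized Hodge structures).

## What is PROVED

* §1 (linear algebra, `K` of characteristic `0`, `W₁`, `W₂` finite-dimensional, `Q = Q₁ ∘ (pr₁ × pr₁) + Q₂ ∘ (pr₂ × pr₂)`):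
  `nondegenerate_compl₁₂_fst_add_compl₁₂_snd`; the `Q`-dual basis of `b₁ ⊔ b₂` is `b₁^{Q₁} ⊔ b₂^{Q₂}` (`dualBasis_prod_inl`,
  `dualBasis_prod_inr`); `dualBasisSum_prod`; **`twoVectorOfForm_compl₁₂_fst_add_compl₁₂_snd`:
  `E_Q = ⋀(inl) E_{Q₁} + ⋀(inr) E_{Q₂}`**.
* §2 (carrier: `H₁`, `H₂` `ℚ`-Hodge structures of the same weight `n` on `V`, `W`, polarizations `Q₁`, `Q₂`):
  **`Polarization.coe_lefschetzClass_prod`: `E_{Q₁ ⊕ Q₂} = ⋀(inl) E_{Q₁} + ⋀(inr) E_{Q₂}`**; for `n` odd, `dim V = 2g₁`, `dim W = 2g₂`: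
  `Polarization.map_inl_mul_map_inr_mem_primitive_prod` (LEMME 1.3.1: `P^{k₁}(H₁) ∧ P^{k₂}(H₂) ⊆ P^{k₁+k₂}(H₁ ⊕ H₂)`),
  `Polarization.lefschetzDual_prod_apply` (`ᶜΛ(x ∧ y) = ᶜΛx ∧ y + x ∧ ᶜΛy`), `Polarization.weylStar_prod_apply` (`w(x ∧ y) = wx ∧ wy`),
  **`Polarization.andreStar_prod_apply_of_mem` (LEMME 1.3.2: `*_H(x ∧ y) = (−1)^{k₁k₂} *_H x ∧ *_H y`)**.

## References

* [Andre1996Motifs] Y. André, *Pour une théorie inconditionnelle des motifs*, Publ. Math. IHÉS 83 (1996), §1.3, Lemme 1.3.1–1.3.2 (pp. 12–13).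
* [Lange2023AbelianVarietiesComplex] H. Lange, *Abelian Varieties over the Complex Numbers* (2023), §7.3.2 (p. 338).
* [DeligneHodgeII1971] P. Deligne, *Théorie de Hodge II*, Publ. Math. IHÉS 40 (1971), 2.1.15.
* [BourbakiAlgebre1a3] N. Bourbaki, *Algèbre*, Ch. III §11 no. 9 (dual bases), §7 no. 7 Prop. 10.
-/

noncomputable section

open scoped TensorProduct

namespace Literature.AlgebraicGeometry.Motives

namespace ExteriorLefschetz

open ExteriorAlgebra

/-! ## §1 The 2-vector of an orthogonal direct sum of forms -/

section Form

variable {K : Type*} [Field K] {W₁ W₂ : Type*} [AddCommGroup W₁] [Module K W₁] [AddCommGroup W₂] [Module K W₂]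
  {Q₁ : LinearMap.BilinForm K W₁} {Q₂ : LinearMap.BilinForm K W₂}

/-- **An orthogonal direct sum of non-degenerate forms is non-degenerate** (`Q((x₁,x₂),(y₁,0)) = Q₁(x₁,y₁)`).
[cite: BourbakiAlgebre1a3, Ch. III §11 no. 9] [cite: DeligneHodgeII1971, 2.1.15] -/
theorem nondegenerate_compl₁₂_fst_add_compl₁₂_snd (h₁ : Q₁.Nondegenerate) (h₂ : Q₂.Nondegenerate) :
    (Q₁.compl₁₂ (LinearMap.fst K W₁ W₂) (LinearMap.fst K W₁ W₂) +
      Q₂.compl₁₂ (LinearMap.snd K W₁ W₂) (LinearMap.snd K W₁ W₂)).Nondegenerate := by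
  refine ⟨fun x hx ↦ Prod.ext ?_ ?_, fun y hy ↦ Prod.ext ?_ ?_⟩
  · refine h₁.1 x.1 fun y₁ ↦ ?_
    simpa using hx (y₁, 0)
  · refine h₂.1 x.2 fun y₂ ↦ ?_
    simpa using hx (0, y₂)
  · refine h₁.2 y.1 fun x₁ ↦ ?_
    simpa using hy (x₁, 0)
  · refine h₂.2 y.2 fun x₂ ↦ ?_
    simpa using hy (0, x₂)

variable {I J : Type*} [Fintype I] [DecidableEq I] [Fintype J] [DecidableEq J]

/-- The `Q`-dual basis of `b₁ ⊔ b₂` on the `W₁`-indices: `(b₁ ⊔ b₂)^Q_{inl i} = (b₁^{Q₁}_i, 0)`. [cite: BourbakiAlgebre1a3, Ch. III §11 no. 9] -/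
theorem dualBasis_prod_inl (h₁ : Q₁.Nondegenerate)
    (hQ : (Q₁.compl₁₂ (LinearMap.fst K W₁ W₂) (LinearMap.fst K W₁ W₂) +
      Q₂.compl₁₂ (LinearMap.snd K W₁ W₂) (LinearMap.snd K W₁ W₂)).Nondegenerate)
    (b₁ : Module.Basis I K W₁) (b₂ : Module.Basis J K W₂) (i : I) :
    LinearMap.BilinForm.dualBasis (Q₁.compl₁₂ (LinearMap.fst K W₁ W₂) (LinearMap.fst K W₁ W₂) +
        Q₂.compl₁₂ (LinearMap.snd K W₁ W₂) (LinearMap.snd K W₁ W₂)) hQ (b₁.prod b₂) (Sum.inl i) =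
      (Q₁.dualBasis h₁ b₁ i, 0) := by
  refine dualBasis_eq_of_forall_apply hQ (b₁.prod b₂) fun t ↦ ?_
  rcases t with t | t
  · simp [Module.Basis.prod_apply, LinearMap.BilinForm.apply_dualBasis_left]
  · simp [Module.Basis.prod_apply]

/-- The `Q`-dual basis of `b₁ ⊔ b₂` on the `W₂`-indices: `(b₁ ⊔ b₂)^Q_{inr j} = (0, b₂^{Q₂}_j)`. [cite: BourbakiAlgebre1a3, Ch. III §11 no. 9] -/
theorem dualBasis_prod_inr (h₂ : Q₂.Nondegenerate)
    (hQ : (Q₁.compl₁₂ (LinearMap.fst K W₁ W₂) (LinearMap.fst K W₁ W₂) +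
      Q₂.compl₁₂ (LinearMap.snd K W₁ W₂) (LinearMap.snd K W₁ W₂)).Nondegenerate)
    (b₁ : Module.Basis I K W₁) (b₂ : Module.Basis J K W₂) (j : J) :
    LinearMap.BilinForm.dualBasis (Q₁.compl₁₂ (LinearMap.fst K W₁ W₂) (LinearMap.fst K W₁ W₂) +
        Q₂.compl₁₂ (LinearMap.snd K W₁ W₂) (LinearMap.snd K W₁ W₂)) hQ (b₁.prod b₂) (Sum.inr j) =
      (0, Q₂.dualBasis h₂ b₂ j) := by
  refine dualBasis_eq_of_forall_apply hQ (b₁.prod b₂) fun t ↦ ?_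
  rcases t with t | t
  · simp [Module.Basis.prod_apply]
  · simp [Module.Basis.prod_apply, LinearMap.BilinForm.apply_dualBasis_left]

/-- **`Σ (b₁ ⊔ b₂)^Q ∧ (b₁ ⊔ b₂) = ⋀(inl)(Σ b₁^{Q₁} ∧ b₁) + ⋀(inr)(Σ b₂^{Q₂} ∧ b₂)`.** [cite: Lange2023AbelianVarietiesComplex, §7.3.2 (p. 338)]
[cite: BourbakiAlgebre1a3, Ch. III §11 no. 9] -/
theorem dualBasisSum_prod (h₁ : Q₁.Nondegenerate) (h₂ : Q₂.Nondegenerate)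
    (hQ : (Q₁.compl₁₂ (LinearMap.fst K W₁ W₂) (LinearMap.fst K W₁ W₂) +
      Q₂.compl₁₂ (LinearMap.snd K W₁ W₂) (LinearMap.snd K W₁ W₂)).Nondegenerate)
    (b₁ : Module.Basis I K W₁) (b₂ : Module.Basis J K W₂) :
    dualBasisSum (Q₁.compl₁₂ (LinearMap.fst K W₁ W₂) (LinearMap.fst K W₁ W₂) +
        Q₂.compl₁₂ (LinearMap.snd K W₁ W₂) (LinearMap.snd K W₁ W₂)) hQ (b₁.prod b₂) =
      ExteriorAlgebra.map (LinearMap.inl K W₁ W₂) (dualBasisSum Q₁ h₁ b₁) +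
        ExteriorAlgebra.map (LinearMap.inr K W₁ W₂) (dualBasisSum Q₂ h₂ b₂) := by
  simp only [dualBasisSum, map_sum, map_mul, map_apply_ι, Fintype.sum_sum_type]
  congr 1
  · refine Finset.sum_congr rfl fun i _ ↦ ?_
    rw [dualBasis_prod_inl h₁ hQ, Module.Basis.prod_apply, Sum.elim_inl, Function.comp_apply, LinearMap.inl_apply, LinearMap.inl_apply]
  · refine Finset.sum_congr rfl fun j _ ↦ ?_
    rw [dualBasis_prod_inr h₂ hQ, Module.Basis.prod_apply, Sum.elim_inr, Function.comp_apply, LinearMap.inr_apply, LinearMap.inr_apply]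

omit [Fintype I] [DecidableEq I] [Fintype J] [DecidableEq J] in
/-- **`E_{Q₁ ⊕ Q₂} = ⋀(inl) E_{Q₁} + ⋀(inr) E_{Q₂}`**: the 2-vector of the orthogonal direct sum of two non-degenerate forms
("`E` considered as an element of `⋀² V`", computed in the concatenated basis). [cite: Lange2023AbelianVarietiesComplex, §7.3.2 (p. 338)]
[cite: DeligneHodgeII1971, 2.1.15] -/
theorem twoVectorOfForm_compl₁₂_fst_add_compl₁₂_snd [CharZero K] [FiniteDimensional K W₁] [FiniteDimensional K W₂]
    (h₁ : Q₁.Nondegenerate) (h₂ : Q₂.Nondegenerate) :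
    twoVectorOfForm (Q₁.compl₁₂ (LinearMap.fst K W₁ W₂) (LinearMap.fst K W₁ W₂) +
        Q₂.compl₁₂ (LinearMap.snd K W₁ W₂) (LinearMap.snd K W₁ W₂)) =
      ExteriorAlgebra.map (LinearMap.inl K W₁ W₂) (twoVectorOfForm Q₁) +
        ExteriorAlgebra.map (LinearMap.inr K W₁ W₂) (twoVectorOfForm Q₂) := by
  classical
  have hQ := nondegenerate_compl₁₂_fst_add_compl₁₂_snd h₁ h₂
  rw [twoVectorOfForm_eq hQ ((Module.finBasis K W₁).prod (Module.finBasis K W₂)), twoVectorOfForm_eq h₁ (Module.finBasis K W₁),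
    twoVectorOfForm_eq h₂ (Module.finBasis K W₂), dualBasisSum_prod h₁ h₂ hQ, smul_add, map_smul, map_smul]

end Form

end ExteriorLefschetz

/-! ## §2 The carrier: `E_{Q₁ ⊕ Q₂}` and André §1.3 on `⋀(V ⊕ W) = H•(A × B)` -/

namespace HodgeStructure

open ExteriorLefschetz ExteriorAlgebra

universe u v

variable {V : Type u} [AddCommGroup V] [Module ℚ V] [Module.Finite ℚ V] {W : Type v} [AddCommGroup W] [Module ℚ W]
  [Module.Finite ℚ W] {n : ℤ} {H₁ : HodgeStructure V n} {H₂ : HodgeStructure W n} (Q₁ : Polarization H₁) (Q₂ : Polarization H₂)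

/-- **`E_{Q₁ ⊕ Q₂} = ⋀(inl) E_{Q₁} + ⋀(inr) E_{Q₂}`** for the product polarization of `H₁ ⊕ H₂` (the Lefschetz operator of a product of
polarized abelian varieties is `L_A ⊗ 1 + 1 ⊗ L_B`). [cite: Andre1996Motifs, §1.3 (p. 12, "𝓛_{X×Y} = p₁*𝓛_X ⊗ p₂*𝓛_Y")]
[cite: DeligneHodgeII1971, 2.1.15] [cite: Lange2023AbelianVarietiesComplex, §7.3.2 (p. 338)] -/
theorem Polarization.coe_lefschetzClass_prod :
    ((Q₁.prod Q₂).lefschetzClass : ExteriorAlgebra ℚ (V × W)) =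
      ExteriorAlgebra.map (LinearMap.inl ℚ V W) (Q₁.lefschetzClass : ExteriorAlgebra ℚ V) +
        ExteriorAlgebra.map (LinearMap.inr ℚ V W) (Q₂.lefschetzClass : ExteriorAlgebra ℚ W) := by
  rw [Polarization.coe_lefschetzClass, Polarization.coe_lefschetzClass, Polarization.coe_lefschetzClass]
  exact twoVectorOfForm_compl₁₂_fst_add_compl₁₂_snd Q₁.nondegenerate Q₂.nondegenerate

variable (hn : Odd n) {g₁ g₂ : ℕ} (hg₁ : Module.finrank ℚ V = 2 * g₁) (hg₂ : Module.finrank ℚ W = 2 * g₂)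

include hn hg₁ hg₂ in
/-- `E_{Q₁ ⊕ Q₂}` is symplectic of genus `g₁ + g₂` (`n` odd, `dim V = 2g₁`, `dim W = 2g₂`). [cite: DeligneHodgeII1971, 2.1.15]
[cite: Lange2023AbelianVarietiesComplex, §7.3.2 (p. 338)] -/
theorem Polarization.isSymplectic_lefschetzClass_prod :
    IsSymplectic ((Q₁.prod Q₂).lefschetzClass : ExteriorAlgebra ℚ (V × W)) (g₁ + g₂) := by
  rw [Q₁.coe_lefschetzClass_prod Q₂]
  exact (Q₁.isSymplectic_lefschetzClass hn hg₁).inl_add_inr (Q₂.isSymplectic_lefschetzClass hn hg₂)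

include hn hg₂ in
/-- **LEMME 1.3.1 on `H•(A × B)`: `P^{k₁}(H₁) ∧ P^{k₂}(H₂) ⊆ P^{k₁+k₂}(H₁ ⊕ H₂)`** (primitive classes for `E_{Q₁}`, `E_{Q₂}`,
`E_{Q₁ ⊕ Q₂}`). [cite: Andre1996Motifs, §1.3 (p. 12) and Lemme 1.3.1 (p. 13)] -/
theorem Polarization.map_inl_mul_map_inr_mem_primitive_prod {k₁ k₂ : ℕ} (hk₁ : k₁ ≤ g₁) (hk₂ : k₂ ≤ g₂) {p : ExteriorAlgebra ℚ V}
    {q : ExteriorAlgebra ℚ W} (hp : p ∈ primitive (Q₁.lefschetzClass : ExteriorAlgebra ℚ V) g₁ k₁)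
    (hq : q ∈ primitive (Q₂.lefschetzClass : ExteriorAlgebra ℚ W) g₂ k₂) :
    ExteriorAlgebra.map (LinearMap.inl ℚ V W) p * ExteriorAlgebra.map (LinearMap.inr ℚ V W) q ∈
      primitive ((Q₁.prod Q₂).lefschetzClass : ExteriorAlgebra ℚ (V × W)) (g₁ + g₂) (k₁ + k₂) := by
  rw [Q₁.coe_lefschetzClass_prod Q₂]
  exact map_inl_mul_map_inr_mem_primitive _ (Q₂.isSymplectic_lefschetzClass hn hg₂).mem hk₁ hk₂ hp hq

include hn hg₁ hg₂ in
/-- **`ᶜΛ_{A×B} (x ∧ y) = ᶜΛ_A x ∧ y + x ∧ ᶜΛ_B y`** on `H•(A × B) = ⋀(V ⊕ W)` (`g₁, g₂ ≥ 1`). [cite: Andre1996Motifs, §1.3 (p. 12)]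
[cite: LooijengaLunts1997, §1 (1.1) p. 4] -/
theorem Polarization.lefschetzDual_prod_apply (h₁ : 0 < g₁) (h₂ : 0 < g₂) (x : ExteriorAlgebra ℚ V) (y : ExteriorAlgebra ℚ W) :
    lefschetzDual ((Q₁.prod Q₂).lefschetzClass : ExteriorAlgebra ℚ (V × W)) (g₁ + g₂)
        (ExteriorAlgebra.map (LinearMap.inl ℚ V W) x * ExteriorAlgebra.map (LinearMap.inr ℚ V W) y) =
      ExteriorAlgebra.map (LinearMap.inl ℚ V W) (lefschetzDual (Q₁.lefschetzClass : ExteriorAlgebra ℚ V) g₁ x) *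
          ExteriorAlgebra.map (LinearMap.inr ℚ V W) y +
        ExteriorAlgebra.map (LinearMap.inl ℚ V W) x *
          ExteriorAlgebra.map (LinearMap.inr ℚ V W) (lefschetzDual (Q₂.lefschetzClass : ExteriorAlgebra ℚ W) g₂ y) := by
  rw [Q₁.coe_lefschetzClass_prod Q₂]
  exact (Q₁.isSymplectic_lefschetzClass hn hg₁).lefschetzDual_inl_add_inr_apply (Q₂.isSymplectic_lefschetzClass hn hg₂) h₁ h₂ x y

include hn hg₁ hg₂ in
/-- **`w_{A×B} (x ∧ y) = w_A x ∧ w_B y`** on `H•(A × B) = ⋀(V ⊕ W)` (`g₁ + g₂ ≥ 1`). [cite: Andre1996Motifs, §1.2 (p. 11) and §1.3 Lemme 1.3.2 (p. 13)] -/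
theorem Polarization.weylStar_prod_apply (h12 : 0 < g₁ + g₂) (x : ExteriorAlgebra ℚ V) (y : ExteriorAlgebra ℚ W) :
    weylStar ((Q₁.prod Q₂).lefschetzClass : ExteriorAlgebra ℚ (V × W)) (g₁ + g₂)
        (ExteriorAlgebra.map (LinearMap.inl ℚ V W) x * ExteriorAlgebra.map (LinearMap.inr ℚ V W) y) =
      ExteriorAlgebra.map (LinearMap.inl ℚ V W) (weylStar (Q₁.lefschetzClass : ExteriorAlgebra ℚ V) g₁ x) *
        ExteriorAlgebra.map (LinearMap.inr ℚ V W) (weylStar (Q₂.lefschetzClass : ExteriorAlgebra ℚ W) g₂ y) := by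
  rw [Q₁.coe_lefschetzClass_prod Q₂]
  exact (Q₁.isSymplectic_lefschetzClass hn hg₁).weylStar_inl_add_inr_apply (Q₂.isSymplectic_lefschetzClass hn hg₂) h12 x y

include hn hg₁ hg₂ in
/-- **ANDRÉ'S LEMME 1.3.2 on `H•(A × B)`: `*_H (x ∧ y) = (−1)^{k₁ k₂} *_H x ∧ *_H y`** for `x ∈ H^{k₁}(A) = ⋀^{k₁} V`,
`y ∈ H^{k₂}(B) = ⋀^{k₂} W` (`*_H` André's involution for `E_{Q₁}`, `E_{Q₂}`, `E_{Q₁ ⊕ Q₂}`; `g₁ + g₂ ≥ 1`).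
[cite: Andre1996Motifs, §1.3 Lemme 1.3.2 (p. 13)] -/
theorem Polarization.andreStar_prod_apply_of_mem (h12 : 0 < g₁ + g₂) {k₁ k₂ : ℕ} {x : ExteriorAlgebra ℚ V} {y : ExteriorAlgebra ℚ W}
    (hx : x ∈ ⋀[ℚ]^k₁ V) (hy : y ∈ ⋀[ℚ]^k₂ W) :
    andreStar ((Q₁.prod Q₂).lefschetzClass : ExteriorAlgebra ℚ (V × W)) (g₁ + g₂)
        (ExteriorAlgebra.map (LinearMap.inl ℚ V W) x * ExteriorAlgebra.map (LinearMap.inr ℚ V W) y) =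
      ((-1 : ℚ) ^ (k₁ * k₂)) • (ExteriorAlgebra.map (LinearMap.inl ℚ V W) (andreStar (Q₁.lefschetzClass : ExteriorAlgebra ℚ V) g₁ x) *
        ExteriorAlgebra.map (LinearMap.inr ℚ V W) (andreStar (Q₂.lefschetzClass : ExteriorAlgebra ℚ W) g₂ y)) := by
  rw [Q₁.coe_lefschetzClass_prod Q₂]
  exact (Q₁.isSymplectic_lefschetzClass hn hg₁).andreStar_inl_add_inr_apply_of_mem (Q₂.isSymplectic_lefschetzClass hn hg₂) h12 hx hy

end HodgeStructure

end Literature.AlgebraicGeometry.Motives
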